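import Mathlib.Analysis.Complex.Basic
import Mathlib.Tactic.Linarith
import Mathlib.Tactic.Ring
import HarnessLib

/-!
# [IUTchIII] Remark 1.2.1 (ii): metrics on a complex archimedean field form an `ℝ_{>0}`-torsor

Mochizuki, *Inter-universal Teichmüller Theory III*, kurims manuscript (May 2020), §1, Remark 1.2.1 (ii),
p. 35 (D-0012 claim key, status disputed; the content typed here is elementary linear algebra and this
file takes no side).

Printed text (p. 35): "Let `k` be a complex archimedean field. … we shall use the term "metric on `k`" to
refer to a Riemannian metric on the real analytic manifold determined by `k` that is compatible with the
two natural almost complex structures on this real analytic manifold and, moreover, is invariant with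
respect to arbitrary additive translation automorphisms of `k`. In passing, we note that any metric on `k`
is also invariant with respect to multiplication by elements `∈ O_k^×`. Next, let us observe that the
metrics on `k` naturally form a torsor over `ℝ_{>0}`. In particular, if we write `k^× ≅ O_k^× × ℝ_{>0}` …,
then one verifies immediately that any metric on `k` is uniquely determined either by its restriction to
`O_k^× ⊆ k` or by its restriction to `ℝ_{>0} ⊆ k`."

Typing (model `k = ℂ`). A translation-invariant Riemannian metric on `ℂ` is a constant positive-definite
symmetric `ℝ`-bilinear form on the tangent space `ℂ`; "compatible with the almost complex structure[s]"
= invariant under multiplication by `i` (equivalently by `−i`). `Metric` below is exactly that structure.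
PROVED: `Metric.apply_eq` — every metric is `B(1,1) · Re(z w̄)` (so the metrics are the positive multiples
of the standard one: an `ℝ_{>0}`-torsor, `Metric.eq_standard`, `Metric.standard_scale`); `Metric.unit_mul_invariant` ("invariant with
respect to multiplication by elements `∈ O_k^×`"); `Metric.ext_of_apply_one` (a metric is determined by its
value on the single vector `1 ∈ O_k^× ∩ ℝ_{>0}`, hence by its restriction to either).
-/

namespace Literature.IUT.LogThetaLattice

open Complex

/-- **IUTchIII:Rmk1.2.1(ii)** (kurims p.35) a "metric on `k`" for `k = ℂ`: a translation-invariant (hence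
constant) Riemannian metric = a positive-definite symmetric `ℝ`-bilinear form on `ℂ`, "compatible with the
… almost complex structure", i.e. invariant under multiplication by `i`. [claim: Mochizuki2012, status: disputed] -/
structure Metric where
  /-- the form `B(z, w)` -/
  B : ℂ → ℂ → ℝ
  /-- additivity in the first variable -/
  add_left : ∀ z z' w, B (z + z') w = B z w + B z' w
  /-- `ℝ`-homogeneity in the first variable -/
  smul_left : ∀ (r : ℝ) z w, B (r * z) w = r * B z w
  /-- symmetry -/
  symm : ∀ z w, B z w = B w z
  /-- compatibility with the almost complex structure: `B(iz, iw) = B(z, w)` -/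
  inv_I : ∀ z w, B (I * z) (I * w) = B z w
  /-- positive definiteness -/
  pos : ∀ z, z ≠ 0 → 0 < B z z

namespace Metric

variable (g : Metric)

/-- **IUTchIII:Rmk1.2.1(ii)** (kurims p.35) additivity in the second variable (from symmetry). [claim: Mochizuki2012, status: disputed] -/
theorem add_right (z w w' : ℂ) : g.B z (w + w') = g.B z w + g.B z w' := by
  rw [g.symm, g.add_left, g.symm w, g.symm w']

/-- **IUTchIII:Rmk1.2.1(ii)** (kurims p.35) homogeneity in the second variable. [claim: Mochizuki2012, status: disputed] -/
theorem smul_right (r : ℝ) (z w : ℂ) : g.B z (r * w) = r * g.B z w := by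
  rw [g.symm, g.smul_left, g.symm]

/-- **IUTchIII:Rmk1.2.1(ii)** (kurims p.35) `B(i, i) = B(1, 1)`. [claim: Mochizuki2012, status: disputed] -/
theorem B_I_I : g.B I I = g.B 1 1 := by
  have := g.inv_I 1 1; simpa using this

/-- **IUTchIII:Rmk1.2.1(ii)** (kurims p.35) `B(1, i) = 0` (from `i`-invariance and symmetry). [claim: Mochizuki2012, status: disputed] -/
theorem B_one_I : g.B 1 I = 0 := by
  have h1 : g.B I (I * I) = g.B 1 I := by simpa using g.inv_I 1 I
  have h2 : g.B I (I * I) = -g.B I 1 := by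
    rw [I_mul_I, show (-1 : ℂ) = ((-1 : ℝ) : ℂ) * 1 by simp, g.smul_right]; ring
  have h3 : g.B I 1 = g.B 1 I := g.symm I 1
  linarith

/-- **IUTchIII:Rmk1.2.1(ii)** (kurims p.35) **every metric is a positive multiple of the standard one**:
`B(z, w) = B(1,1) · Re(z · w̄)`. [claim: Mochizuki2012, status: disputed] -/
theorem apply_eq (z w : ℂ) : g.B z w = g.B 1 1 * (z * starRingEnd ℂ w).re := by
  -- decompose `z = a + b i`, `w = c + d i` and expand by bilinearity
  have hz : z = (z.re : ℂ) * 1 + (z.im : ℂ) * I := by simp [re_add_im]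
  have hw : w = (w.re : ℂ) * 1 + (w.im : ℂ) * I := by simp [re_add_im]
  have hII := g.B_I_I
  have h1I := g.B_one_I
  have hI1 : g.B I 1 = 0 := by rw [g.symm]; exact h1I
  conv_lhs => rw [hz, hw]
  simp only [g.add_left, g.add_right, g.smul_left, g.smul_right, hII, h1I, hI1, mul_zero, add_zero,
    zero_add]
  simp only [mul_re, conj_re, conj_im]
  ring

/-- **IUTchIII:Rmk1.2.1(ii)** (kurims p.35) the scale `B(1,1)` is positive. [claim: Mochizuki2012, status: disputed] -/
theorem scale_pos : 0 < g.B 1 1 := g.pos 1 one_ne_zero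

/-- **IUTchIII:Rmk1.2.1(ii)** (kurims p.35) "any metric on `k` is also invariant with respect to
multiplication by elements `∈ O_k^×`" (`|u| = 1`). [claim: Mochizuki2012, status: disputed] -/
theorem unit_mul_invariant (u : ℂ) (hu : ‖u‖ = 1) (z w : ℂ) : g.B (u * z) (u * w) = g.B z w := by
  have : u * z * starRingEnd ℂ (u * w) = (u * starRingEnd ℂ u) * (z * starRingEnd ℂ w) := by
    rw [map_mul]; ring
  rw [g.apply_eq (u * z) (u * w), g.apply_eq z w, this, mul_conj, Complex.normSq_eq_norm_sq, hu]
  simp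

/-- **IUTchIII:Rmk1.2.1(ii)** (kurims p.35) "uniquely determined either by its restriction to `O_k^×` or by
its restriction to `ℝ_{>0}`": two metrics agreeing on the single vector `1 ∈ O_k^× ∩ ℝ_{>0}` are equal.
[claim: Mochizuki2012, status: disputed] -/
theorem ext_of_apply_one {g g' : Metric} (h : g.B 1 1 = g'.B 1 1) : g.B = g'.B := by
  funext z w
  rw [g.apply_eq, g'.apply_eq, h]

/-- **IUTchIII:Rmk1.2.1(ii)** (kurims p.35) the standard metric `Re(z w̄)` scaled by `c > 0`.
[claim: Mochizuki2012, status: disputed] -/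
def standard (c : ℝ) (hc : 0 < c) : Metric where
  B z w := c * (z * starRingEnd ℂ w).re
  add_left z z' w := by rw [add_mul, add_re]; ring
  smul_left r z w := by
    rw [mul_assoc, show ((r : ℂ) * (z * starRingEnd ℂ w)).re = r * (z * starRingEnd ℂ w).re by
      simp]; ring
  symm z w := by
    congr 1
    rw [← conj_re (w * starRingEnd ℂ z), map_mul, conj_conj, mul_comm]
  inv_I z w := by
    congr 1
    rw [map_mul, conj_I]
    ring_nf
    rw [I_sq]; ring_nf
  pos z hz := by
    rw [mul_conj, ofReal_re]
    exact mul_pos hc (Complex.normSq_pos.mpr hz)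

/-- **IUTchIII:Rmk1.2.1(ii)** (kurims p.35) "the metrics on `k` naturally form a torsor over `ℝ_{>0}`": the
map `g ↦ B(1,1)` identifies the forms of metrics with the positive reals (every metric is `standard c`
for `c = B(1,1)`). [claim: Mochizuki2012, status: disputed] -/
theorem eq_standard (g : Metric) : g.B = (standard (g.B 1 1) g.scale_pos).B := by
  funext z w
  rw [g.apply_eq]; rfl

/-- **IUTchIII:Rmk1.2.1(ii)** (kurims p.35) the scale of `standard c` is `c`. [claim: Mochizuki2012, status: disputed] -/
theorem standard_scale (c : ℝ) (hc : 0 < c) : (standard c hc).B 1 1 = c := by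
  simp [standard]

end Metric

end Literature.IUT.LogThetaLattice
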